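import Summits.PneNP.PneNP.Theorems.NegLimitedDoorAdvantageCounting

/-!
# Route NegLimited — the door crux `PlantedCliqueMonotoneAdvantageQuart` is TIGHT at `ε = 1/2` (stmt-PneNP-19860)

Helper file for the door item `NegLimited.NeglimitedEpsLogNegationsR` (stmt-PneNP-19860, line
`correlation-door`): ROUND-8 §B.2 test (4)(b).  The open crux of the line,
`PlantedCliqueMonotoneAdvantageQuart` (`NegLimitedDoorOfPlantedClique.lean`), asks for SOME `ε > 0`
such that every polynomial-size MONOTONE circuit `M` on the edges of `K_m` has planted-clique flip
probability `plantFlipProb m ⌊m^{1/4}⌋ ½ M ≤ m^{-ε}` eventually.  Here we prove that no `ε > 1/2`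
can serve (`plantedCliqueMonotoneAdvantage_false_of_half_lt`): the EDGE-COUNT THRESHOLD
`[e(G) ≥ θ]` — a monotone circuit with `≤ m⁴` gates (`NegLimitedDoorThresholdCircuits.lean`) — has,
for a suitable `θ`, flip probability `≥ (3/256)·m^{-1/2}` (`exists_threshold_circuit_plantFlipProb_ge`).
So the exponent range of the crux is `0 < ε ≤ 1/2`, and the `(1 - 2κ)·log₂ m` ceiling of ROUND-8
§B.4 (here `κ = 1/4`) is attained by the simplest symmetric statistic.

Proof (an averaging argument; no local limit theorem is needed).  Under `G ∼ G(m, ½)` and a planted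
`k`-set `A` (`K = C(k,2)` pairs), `e(G ∪ K_A) = e(G) + Z_A(G)` with `Z_A` the number of absent pairs
inside `A`, `E[Z_A] = K/2`, `Z_A ≤ K`.  The threshold `θ` flips exactly when `e(G) < θ ≤ e(G) + Z_A`.
Summing over the window `W = [N/2 - t, N/2 + t + K]` of thresholds (`N = C(m,2)`, `t = ⌊√N⌋ + 1`):
whenever `|2e(G) - N| ≤ 2t` ALL `Z_A(G)` flipping thresholds lie in `W`, so
`Σ_{θ ∈ W} Pr[flip_θ] ≥ E[Z_A] - K·Pr[|2e(G) - N| > 2t] ≥ K/2 - K·N/(4t²) ≥ K/4` by Chebyshev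
(`Σ_G (2e(G) - N)² = N·2^N`, proved by expanding the square of `Σ_e (2x_e - 1)` and killing the cross
terms with the one-edge flip involution), and some `θ ∈ W` has
`Pr[flip_θ] ≥ K/(4|W|) ≥ K/(16m) ≥ (3/256)·m^{-1/2}` (`k = ⌊√⌊√m⌋⌋ ≥ m^{1/4} - 1`).

References: B. Rossman, *Correlation bounds against monotone NC¹*, CCC 2015, §1 (p. 393: the
planted-clique challenge for monotone circuits) [Rossman2015]; cell record HOME/pnp-ideate-p3/ROUND-8.md
§B.2 (4)(b), §B.4.
-/

set_option linter.dupNamespace false -- `Summit.PneNP.PneNP.…`: summit = sub-problem name (D-0017 single-conjunct layout)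

noncomputable section

namespace Summit.PneNP.PneNP.Theorems.NegLimitedDoor.Tightness

open Finset Filter
open Literature.Computability.Complexity
open Summit.PneNP.PneNP.Theorems.NegLimitedDoor.Threshold

/-! ## Part C — the flip probability of a threshold circuit -/

section FlipProb

variable {m : ℕ}

/-- At density `½` every graph has the same weight `2^{-N}`. [folklore] -/
theorem gnpWeight_half (x : ↥(⊤ : SimpleGraph (Fin m)).edgeSet → Bool) :
    gnpWeight m (1 / 2) x = (1 / 2) ^ Fintype.card ↥(⊤ : SimpleGraph (Fin m)).edgeSet := by
  rw [gnpWeight, card_edgeSet_top_fin]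
  have h : edgeCount x ≤ m.choose 2 := by
    rw [edgeCount, ← card_edgeSet_top_fin m, ← card_univ]
    exact card_le_card (filter_subset _ _)
  rw [show (1 : ℝ) - 1 / 2 = 1 / 2 by norm_num, ← pow_add, Nat.add_sub_cancel' h]

/-- **The planted flip probability at density `½` is the normalised flip count**:
`plantFlipProb m k ½ f = C(m,k)⁻¹ · 2^{-N} · Σ_A #{x | f(x) ≠ f(x ∪ K_A)}`. [folklore] -/
theorem plantFlipProb_half_eq (m k : ℕ)
    (f : (↥(⊤ : SimpleGraph (Fin m)).edgeSet → Bool) → Bool) :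
    plantFlipProb m k (1 / 2) f = ((m.choose k : ℕ) : ℝ)⁻¹ *
      ((1 / 2) ^ Fintype.card ↥(⊤ : SimpleGraph (Fin m)).edgeSet *
        ∑ A ∈ powersetCard k (univ : Finset (Fin m)),
          (#(univ.filter fun x : ↥(⊤ : SimpleGraph (Fin m)).edgeSet → Bool =>
            f x ≠ f (plantClique A x)) : ℝ)) := by
  unfold plantFlipProb
  congr 1
  rw [mul_sum]
  refine sum_congr rfl fun A _ => ?_
  rw [card_filter, Nat.cast_sum, mul_sum]
  refine sum_congr rfl fun x _ => ?_
  rw [gnpWeight_half]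
  by_cases h : f x = f (plantClique A x)
  · simp [h]
  · simp [h]

/-- **Some threshold in the window has planted flip probability `≥ K/(4|W|)`** (`k ≤ m`,
`t ≥ 1`, `t² ≥ N`). [folklore] -/
theorem exists_threshold_plantFlipProb_ge (m k t : ℕ) (hkm : k ≤ m) (ht : 1 ≤ t)
    (htN : Fintype.card ↥(⊤ : SimpleGraph (Fin m)).edgeSet ≤ t ^ 2) :
    ∃ θ ∈ window (Fintype.card ↥(⊤ : SimpleGraph (Fin m)).edgeSet) t (k.choose 2),
      ((k.choose 2 : ℕ) : ℝ) /
          (4 * #(window (Fintype.card ↥(⊤ : SimpleGraph (Fin m)).edgeSet) t (k.choose 2))) ≤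
        plantFlipProb m k (1 / 2) (thrFn θ) := by
  obtain ⟨θ, hθW, hθ⟩ := exists_threshold_flipCount_ge m k t ht htN
  refine ⟨θ, hθW, ?_⟩
  set N := Fintype.card ↥(⊤ : SimpleGraph (Fin m)).edgeSet with hN
  set W := window N t (k.choose 2) with hW
  have hC : (0 : ℝ) < (m.choose k : ℝ) := by exact_mod_cast Nat.choose_pos hkm
  have hWpos : (0 : ℝ) < (#W : ℝ) := by exact_mod_cast (window_nonempty _ _ _).card_pos
  have h2N : (0 : ℝ) < (2 : ℝ) ^ N := by positivity
  rw [plantFlipProb_half_eq]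
  have hθR : ((m.choose k : ℕ) : ℝ) * (k.choose 2 : ℕ) * 2 ^ N ≤ 4 * #W * (flipCount m k θ : ℝ) := by
    exact_mod_cast hθ
  rw [flipCount, Nat.cast_sum] at hθR
  rw [div_le_iff₀ (by positivity)]
  have hhalf : ((1 : ℝ) / 2) ^ N = (2 ^ N)⁻¹ := by rw [one_div, inv_pow]
  rw [hhalf]
  calc ((k.choose 2 : ℕ) : ℝ) = ((m.choose k : ℕ) : ℝ)⁻¹ * ((2 : ℝ) ^ N)⁻¹ *
        (((m.choose k : ℕ) : ℝ) * (k.choose 2 : ℕ) * 2 ^ N) := by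
        field_simp
    _ ≤ ((m.choose k : ℕ) : ℝ)⁻¹ * ((2 : ℝ) ^ N)⁻¹ * (4 * #W * ∑ A ∈ powersetCard k univ,
          (#(univ.filter fun x : ↥(⊤ : SimpleGraph (Fin m)).edgeSet → Bool =>
            thrFn θ x ≠ thrFn θ (plantClique A x)) : ℝ)) :=
        mul_le_mul_of_nonneg_left hθR (by positivity)
    _ = _ := by ring

end FlipProb

/-! ## Part D — numerics at `k = ⌊√⌊√m⌋⌋`, `t = ⌊√N⌋ + 1`, and the tightness theorems -/

section Final

/-- Arithmetic of `N = C(m,2)` for `m ≥ 9`: `N < m²`, `4m ≤ N`, `2N ≤ m²`. [folklore] -/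
theorem choose_two_bounds {m : ℕ} (hm : 9 ≤ m) :
    m.choose 2 < m * m ∧ 4 * m ≤ m.choose 2 ∧ 2 * m.choose 2 ≤ m * m := by
  have hQ : 9 * m ≤ m * m := Nat.mul_le_mul_right m hm
  have hP : m * (m - 1) = m * m - m := Nat.mul_sub_one m m
  rw [Nat.choose_two_right, hP]
  omega

/-- Arithmetic of the clique size `k = ⌊√⌊√m⌋⌋` for `m ≥ 81`: `3 ≤ k`, `k ≤ m`, `C(k,2) ≤ m`,
`m < (k+1)⁴`. [folklore] -/
theorem quart_bounds {m : ℕ} (hm : 81 ≤ m) :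
    3 ≤ Nat.sqrt (Nat.sqrt m) ∧ Nat.sqrt (Nat.sqrt m) ≤ m ∧ (Nat.sqrt (Nat.sqrt m)).choose 2 ≤ m ∧
      m < (Nat.sqrt (Nat.sqrt m) + 1) ^ 4 := by
  set r := Nat.sqrt m with hr
  set k := Nat.sqrt r with hk
  have hr9 : 9 ≤ r := Nat.le_sqrt.2 (by omega)
  have hk3 : 3 ≤ k := Nat.le_sqrt.2 (by omega)
  have hm_lt : m < (r + 1) * (r + 1) := Nat.lt_succ_sqrt m
  have hr_lt : r < (k + 1) * (k + 1) := Nat.lt_succ_sqrt r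
  have hkk : k * k ≤ r := Nat.sqrt_le r
  have hrm : r ≤ m := Nat.sqrt_le_self m
  have hK : k.choose 2 ≤ k * k := by
    rw [Nat.choose_two_right]
    exact (Nat.div_le_self _ _).trans (Nat.mul_le_mul_left k (Nat.sub_le k 1))
  refine ⟨hk3, ?_, ?_, ?_⟩
  · nlinarith
  · omega
  · have h1 : (r + 1) * (r + 1) ≤ ((k + 1) * (k + 1)) * ((k + 1) * (k + 1)) :=
      Nat.mul_le_mul (by omega) (by omega)
    calc m < (r + 1) * (r + 1) := hm_lt
      _ ≤ ((k + 1) * (k + 1)) * ((k + 1) * (k + 1)) := h1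
      _ = (k + 1) ^ 4 := by ring

/-- The real-number step: `16 · C(k,2) ≥ 3 (k+1)²` for `k ≥ 3`, hence `16 K ≥ 3 √m` when `m ≤ (k+1)⁴`.
[folklore] -/
theorem three_sqrt_le_sixteen_K {m k : ℕ} (hk : 3 ≤ k) (hmk : m < (k + 1) ^ 4) :
    3 * Real.sqrt m ≤ 16 * ((k.choose 2 : ℕ) : ℝ) := by
  have hK : ((k.choose 2 : ℕ) : ℝ) = (k : ℝ) * ((k : ℝ) - 1) / 2 := Nat.cast_choose_two ℝ k
  have hk3 : (3 : ℝ) ≤ k := by exact_mod_cast hk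
  have h16 : 3 * ((k : ℝ) + 1) ^ 2 ≤ 16 * ((k.choose 2 : ℕ) : ℝ) := by
    rw [hK]; nlinarith
  have hsq : Real.sqrt m ≤ ((k : ℝ) + 1) ^ 2 := by
    have hle : (m : ℝ) ≤ (((k : ℝ) + 1) ^ 2) ^ 2 := by
      have : ((m : ℕ) : ℝ) ≤ (((k + 1) ^ 4 : ℕ) : ℝ) := by exact_mod_cast hmk.le
      calc (m : ℝ) ≤ (((k + 1) ^ 4 : ℕ) : ℝ) := this
        _ = (((k : ℝ) + 1) ^ 2) ^ 2 := by push_cast; ring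
    calc Real.sqrt m ≤ Real.sqrt ((((k : ℝ) + 1) ^ 2) ^ 2) := Real.sqrt_le_sqrt hle
      _ = ((k : ℝ) + 1) ^ 2 := Real.sqrt_sq (by positivity)
  linarith

/-- **A threshold circuit beats `m^{-1/2}`**: for `m ≥ 81` some edge-count threshold `[e(G) ≥ θ]`,
computed by a `{∧₂, ∨₂}`-circuit with at most `m⁴` gates, has planted-`⌊m^{1/4}⌋`-clique flip
probability at least `(3/256)·m^{-1/2}` at density `½`. [folklore] -/
theorem exists_threshold_circuit_plantFlipProb_ge {m : ℕ} (hm : 81 ≤ m) :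
    ∃ M : Circuit ↥(⊤ : SimpleGraph (Fin m)).edgeSet, M.IsOver monotoneBasis ∧ M.size ≤ m ^ 4 ∧
      (3 / 256 : ℝ) * (m : ℝ) ^ (-(1 / 2 : ℝ)) ≤
        plantFlipProb m (Nat.sqrt (Nat.sqrt m)) (1 / 2) M.eval := by
  obtain ⟨hk3, hkm, hKm, hmk⟩ := quart_bounds hm
  obtain ⟨hNmm, h4m, h2N⟩ := choose_two_bounds (show 9 ≤ m by omega)
  set k := Nat.sqrt (Nat.sqrt m) with hk
  set N := m.choose 2 with hNdef
  set K := k.choose 2 with hKdef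
  set t := Nat.sqrt N + 1 with htdef
  have hN : Fintype.card ↥(⊤ : SimpleGraph (Fin m)).edgeSet = N := card_edgeSet_top_fin m
  have htN : N ≤ t ^ 2 := by
    have := Nat.lt_succ_sqrt N
    rw [htdef, sq]; exact this.le
  have htm : t ≤ m := by
    have : Nat.sqrt N < m := Nat.sqrt_lt.2 hNmm
    omega
  -- the threshold from the averaging argument
  obtain ⟨θ, hθW, hθ⟩ := exists_threshold_plantFlipProb_ge m k t hkm (by omega) (by rw [hN]; exact htN)
  rw [hN] at hθW hθ
  have hW4 : #(window N t K) ≤ 4 * m := (card_window_le N t K).trans (by omega)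
  have hWpos : 0 < #(window N t K) := (window_nonempty N t K).card_pos
  have hθ1 : 1 ≤ θ ∧ θ ≤ N := by
    simp only [window, mem_Icc] at hθW
    omega
  -- the circuit
  obtain ⟨M, hMB, hMs, hMe⟩ := exists_monotone_circuit_thrFn
    (ι := ↥(⊤ : SimpleGraph (Fin m)).edgeSet) hθ1.1 (by rw [hN]; exact hθ1.2)
  refine ⟨M, hMB, ?_, ?_⟩
  · rw [hN] at hMs
    refine hMs.trans ?_
    have h4 : m ^ 4 = (m * m) * (m * m) := by ring
    rw [h4]
    nlinarith [hθ1.2, Nat.zero_le N]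
  · rw [plantFlipProb_congr hMe]
    refine le_trans ?_ hθ
    -- `(3/256) m^{-1/2} ≤ K / (4 |W|)`
    have hm0 : (0 : ℝ) < m := by exact_mod_cast (show 0 < m by omega)
    have hsqrt : (m : ℝ) ^ (-(1 / 2 : ℝ)) = (Real.sqrt m)⁻¹ := by
      rw [Real.rpow_neg hm0.le, Real.sqrt_eq_rpow]
    have hs0 : 0 < Real.sqrt m := Real.sqrt_pos.2 hm0
    have hss : Real.sqrt m * Real.sqrt m = m := Real.mul_self_sqrt hm0.le
    have h3 := three_sqrt_le_sixteen_K hk3 hmk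
    have hW4R : ((#(window N t K) : ℕ) : ℝ) ≤ 4 * m := by exact_mod_cast hW4
    have hWposR : (0 : ℝ) < ((#(window N t K) : ℕ) : ℝ) := by exact_mod_cast hWpos
    rw [hsqrt, le_div_iff₀ (by positivity)]
    -- `(3/256) (√m)⁻¹ (4 |W|) ≤ K`
    calc 3 / 256 * (Real.sqrt m)⁻¹ * (4 * ((#(window N t K) : ℕ) : ℝ))
        ≤ 3 / 256 * (Real.sqrt m)⁻¹ * (16 * m) := by
          refine mul_le_mul_of_nonneg_left (by linarith) (by positivity)
      _ = 3 / 16 * Real.sqrt m := by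
          field_simp
          nlinarith [hss]
      _ ≤ ((K : ℕ) : ℝ) := by rw [hKdef]; linarith

/-- **The door crux is tight at `ε = 1/2`**: for every `ε > 1/2` it is FALSE that all polynomial-size
monotone circuits have planted-`⌊m^{1/4}⌋`-clique flip probability `≤ m^{-ε}` eventually — the
edge-count threshold (`≤ m⁴` gates) has flip probability `≥ (3/256)·m^{-1/2}`.  (The crux
`PlantedCliqueMonotoneAdvantageQuart` itself asks only for SOME `ε > 0` and is untouched.)
[cite: Rossman2015, §1] -/
theorem plantedCliqueMonotoneAdvantage_false_of_half_lt {ε : ℝ} (hε : 1 / 2 < ε) :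
    ¬ (∀ c : ℕ, ∀ᶠ m : ℕ in atTop, ∀ M : Circuit ↥(⊤ : SimpleGraph (Fin m)).edgeSet,
        M.IsOver monotoneBasis → M.size ≤ m ^ c →
          plantFlipProb m (Nat.sqrt (Nat.sqrt m)) (1 / 2) M.eval ≤ (m : ℝ) ^ (-ε)) := by
  intro h
  have hsmall : ∀ᶠ m : ℕ in atTop,
      (m : ℝ) ^ (-ε) < (3 / 256 : ℝ) * (m : ℝ) ^ (-(1 / 2 : ℝ)) := by
    have hδ : 0 < ε - 1 / 2 := by linarith
    have ht : Tendsto (fun m : ℕ => (m : ℝ) ^ (-(ε - 1 / 2))) atTop (nhds 0) :=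
      (tendsto_rpow_neg_atTop hδ).comp tendsto_natCast_atTop_atTop
    filter_upwards [ht.eventually (gt_mem_nhds (show (0 : ℝ) < 3 / 256 by norm_num)),
      eventually_gt_atTop 0] with m hlt hm0
    have hm0' : (0 : ℝ) < m := by exact_mod_cast hm0
    have hsplit : (m : ℝ) ^ (-ε) = (m : ℝ) ^ (-(ε - 1 / 2)) * (m : ℝ) ^ (-(1 / 2 : ℝ)) := by
      rw [← Real.rpow_add hm0']; ring_nf
    rw [hsplit]
    exact mul_lt_mul_of_pos_right hlt (Real.rpow_pos_of_pos hm0' _)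
  obtain ⟨m, hm81, hP, hQ⟩ := ((eventually_ge_atTop 81).and ((h 4).and hsmall)).exists
  obtain ⟨M, hMB, hMs, hge⟩ := exists_threshold_circuit_plantFlipProb_ge hm81
  have := hP M hMB hMs
  linarith

/-- **Every admissible exponent of the door crux is at most `1/2`**: if `ε` witnesses the body of
`PlantedCliqueMonotoneAdvantageQuart` (all polynomial-size monotone circuits have planted flip
probability `≤ m^{-ε}` eventually), then `ε ≤ 1/2`. [cite: Rossman2015, §1] -/
theorem plantedCliqueMonotoneAdvantage_exponent_le_half {ε : ℝ}
    (h : ∀ c : ℕ, ∀ᶠ m : ℕ in atTop, ∀ M : Circuit ↥(⊤ : SimpleGraph (Fin m)).edgeSet,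
      M.IsOver monotoneBasis → M.size ≤ m ^ c →
        plantFlipProb m (Nat.sqrt (Nat.sqrt m)) (1 / 2) M.eval ≤ (m : ℝ) ^ (-ε)) :
    ε ≤ 1 / 2 :=
  not_lt.1 fun hε => plantedCliqueMonotoneAdvantage_false_of_half_lt hε h

/-- **The crux restated with its exponent range**: `PlantedCliqueMonotoneAdvantageQuart` (door item
stmt-PneNP-19860, line `correlation-door`, stub 6 — OPEN) is equivalent to its restriction to
exponents `0 < ε ≤ 1/2`; the half-line `ε > 1/2` is excluded by the edge-count threshold.
[cite: Rossman2015, §1] -/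
theorem plantedCliqueMonotoneAdvantageQuart_iff_exponent_le_half :
    PlantedCliqueMonotoneAdvantageQuart ↔ ∃ ε : ℝ, 0 < ε ∧ ε ≤ 1 / 2 ∧ ∀ c : ℕ, ∀ᶠ m : ℕ in atTop,
      ∀ M : Circuit ↥(⊤ : SimpleGraph (Fin m)).edgeSet, M.IsOver monotoneBasis → M.size ≤ m ^ c →
        plantFlipProb m (Nat.sqrt (Nat.sqrt m)) (1 / 2) M.eval ≤ (m : ℝ) ^ (-ε) := by
  constructor
  · rintro ⟨ε, hε, h⟩
    exact ⟨ε, hε, plantedCliqueMonotoneAdvantage_exponent_le_half h, h⟩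
  · rintro ⟨ε, hε, -, h⟩
    exact ⟨ε, hε, h⟩

end Final

/-! ## Part E — the edge-count floor for every planted size (`C(k,2) ≤ m`) -/

section General

/-- **The edge-count floor for a general planted size**: for `m ≥ 9`, `k ≤ m` and `K = C(k,2) ≤ m`,
some edge-count threshold (a `{∧₂, ∨₂}`-circuit with `≤ m⁴` gates) has planted-`k`-clique flip
probability `≥ K/(16m)` at density `½` — the `k²/m` floor behind the `(1 - 2κ)·log₂ m` ceiling of
ROUND-8 §B.4 for every planted size `k = m^κ`, `κ < 1/2`. [folklore] -/
theorem exists_threshold_circuit_plantFlipProb_ge_choose {m k : ℕ} (hm : 9 ≤ m) (hkm : k ≤ m)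
    (hKm : k.choose 2 ≤ m) :
    ∃ M : Circuit ↥(⊤ : SimpleGraph (Fin m)).edgeSet, M.IsOver monotoneBasis ∧ M.size ≤ m ^ 4 ∧
      ((k.choose 2 : ℕ) : ℝ) / (16 * m) ≤ plantFlipProb m k (1 / 2) M.eval := by
  obtain ⟨hNmm, h4m, h2N⟩ := choose_two_bounds hm
  set N := m.choose 2 with hNdef
  set K := k.choose 2 with hKdef
  set t := Nat.sqrt N + 1 with htdef
  have hN : Fintype.card ↥(⊤ : SimpleGraph (Fin m)).edgeSet = N := card_edgeSet_top_fin m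
  have htN : N ≤ t ^ 2 := by
    have := Nat.lt_succ_sqrt N
    rw [htdef, sq]; exact this.le
  have htm : t ≤ m := by
    have : Nat.sqrt N < m := Nat.sqrt_lt.2 hNmm
    omega
  obtain ⟨θ, hθW, hθ⟩ := exists_threshold_plantFlipProb_ge m k t hkm (by omega) (by rw [hN]; exact htN)
  rw [hN] at hθW hθ
  have hW4 : #(window N t K) ≤ 4 * m := (card_window_le N t K).trans (by omega)
  have hWpos : 0 < #(window N t K) := (window_nonempty N t K).card_pos
  have hθ1 : 1 ≤ θ ∧ θ ≤ N := by
    simp only [window, mem_Icc] at hθW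
    omega
  obtain ⟨M, hMB, hMs, hMe⟩ := exists_monotone_circuit_thrFn
    (ι := ↥(⊤ : SimpleGraph (Fin m)).edgeSet) hθ1.1 (by rw [hN]; exact hθ1.2)
  refine ⟨M, hMB, ?_, ?_⟩
  · rw [hN] at hMs
    refine hMs.trans ?_
    have h4 : m ^ 4 = (m * m) * (m * m) := by ring
    rw [h4]
    nlinarith [hθ1.2, Nat.zero_le N]
  · rw [plantFlipProb_congr hMe]
    refine le_trans ?_ hθ
    have hW4R : ((#(window N t K) : ℕ) : ℝ) ≤ 4 * m := by exact_mod_cast hW4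
    have hWposR : (0 : ℝ) < ((#(window N t K) : ℕ) : ℝ) := by exact_mod_cast hWpos
    exact div_le_div_of_nonneg_left (by positivity) (by positivity) (by linarith)

end General

end Summit.PneNP.PneNP.Theorems.NegLimitedDoor.Tightness

end
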